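import Summits.AtomisticToContinuum.Crystallization.Theorems.OverbindingBudgetPeriodicWrap

/-!
# OverbindingBudget · generation 23 · node «PeriodicPricing» — part 3/3: `PeriodicDefectPricing ⟹ TypeFreeLaw`, and the cone

Helper file for the crux `OverbindingBudget.RobustDefectLimitWindows` (RDEF, stmt-AtomisticToContinuum-31280); line v7 «HostedDustCut»
(skeleton 624a0fa0…) untouched.

## The periodisation theorem (0 sorry)

**`typeFreeLaw_of_periodicDefectPricing : PeriodicDefectPricing → 0 ≤ D → TypeFreeLaw D`.**  Contrapositive of the law: a texture `Y`
(uniformly discrete with constant `δ`, covering radius `< 9/10`, thin-cored at spacing `a` within `D`, `L`-dense margin-`t` robust violators)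
that is FLAT at level `γ/4` on every large cube is wrapped TIGHTLY onto the torus `ℝ³/ℓℤ³` (part 2: `W = F' + ℓℤ³`, `F'` the cube patch minus
its top unit slabs).  The wrap is `ℓℤ³`-periodic, `min(δ,1)`-separated, of covering radius `< 5`, thin-cored within `3D+8`, with
`(3L⁺+11)`-dense violators — so `PeriodicDefectPricing` prices its period cell at `≥ γ ℓ³` — while its cell charge is at most
`(flat charge ≤ γ/4 ℓ³) + (cube cross term ≤ γ/4 ℓ³, stmt-30251 `stub_crossTermSmall`) + (rim cost ≤ (2C_δ + 2|e|)·#rim = O(ℓ²))`,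
a contradiction for `ℓ` large.  Hence the texture is charged at level `γ/4`: the type-free law.

## The cone through the periodic normal form (0 sorry)

* `dustLaw_of_periodicDefectPricing : PeriodicDefectPricing → DustLaw` (registered stub 5 of line v7, BY NAME);
* `hostedTarget_of_periodicDefectPricing : PeriodicDefectPricing → HostedTarget 10`;
* **`rdef_of_periodicDefectPricing_coherent : PeriodicDefectPricing → CleanlessExcessT → CoherentResidual 10 → RobustDefectLimitWindows`** —
  the minimal cone of record (generation 20: laws 3, 4, 5 ∧ CleanlessExcessT ∧ CoherentResidual 10) with its THREE idea-needed laws replaced by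
  ONE statement about periodic textures.

Axis tags (honest): on the texture axis `PeriodicDefectPricing` is the type-free law RESTRICTED to periodic textures (weaker); on the
uniformity axis it asks `γ` uniform in the texture (stronger than `TypeFreeLaw`, whose `η` may depend on `Y`).  The converse
`TypeFreeLaw-uniform ⟹ PeriodicDefectPricing` is routine tiling and is not needed by the cone.
-/

namespace Summit.AtomisticToContinuum.Crystallization.Theorems.OverbindingBudgetPeriodicPricing

open scoped BigOperators Topology
open Literature.MathematicalPhysics.StatisticalMechanics (UniformlyDiscrete lennardJones groundStateEnergy)
open Summit.AtomisticToContinuum.Crystallization.Theses.OverbindingBudget (RobustDefectLimitWindows)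
open Summit.AtomisticToContinuum.Crystallization.Theorems.OverbindingBudgetViolatorDensityFloor (RT)
open Summit.AtomisticToContinuum.Crystallization.Theorems.OverbindingBudgetWallTensionLever (ThinCores)
open Summit.AtomisticToContinuum.Crystallization.Theorems.OverbindingBudgetCleanlessCut (HostedTarget)
open Summit.AtomisticToContinuum.Crystallization.Theorems.OverbindingBudgetGradedBareness (CleanlessExcessT)
open Summit.AtomisticToContinuum.Crystallization.Theorems.OverbindingBudgetCoherentCut (CoherentResidual)
open Summit.AtomisticToContinuum.Crystallization.Theorems.OverbindingBudgetMinimalCone (DustLaw)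
open Summit.AtomisticToContinuum.Crystallization.Theorems.OverbindingBudgetCubeBookkeeping (stub_siteSumSplit)
open Summit.AtomisticToContinuum.Crystallization.Theorems.OverbindingBudgetCubeChargeLaw (stub_crossTermSmall)
open Summit.AtomisticToContinuum.Crystallization.Theorems.OverbindingBudgetExcessInstability (finite_inter_cube)
open Summit.AtomisticToContinuum.Crystallization.Theorems.OverbindingBudgetPeriodicPricingStatements
open Summit.AtomisticToContinuum.Crystallization.Theorems.OverbindingBudgetPeriodicWrap

/-! ## §M  Three bookkeeping lemmas and the periodisation theorem -/

/-- **A.** The cell charge of the wrap is at most the pair sum of the untrimmed patch plus the rim cost minus `2e·#F'`. -/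
theorem wrap_cell_charge_le {ℓ δ e C : ℝ} {Y : Set (EuclideanSpace ℝ (Fin 3))} {c : EuclideanSpace ℝ (Fin 3)}
    {F F' : Finset (EuclideanSpace ℝ (Fin 3))} (hℓ : 0 ≤ ℓ) (hδ : 0 < δ) (hTrim : IsTrim Y c ℓ F')
    (hsep : ∀ x ∈ Y, ∀ y ∈ Y, x ≠ y → δ ≤ dist x y) (hFsep : ∀ z ∈ F, ∀ w ∈ F, z ≠ w → δ ≤ dist z w)
    (hC : C = 432 * (δ⁻¹ ^ 6 + 1) * δ⁻¹ ^ 3 * δ⁻¹ ^ 3)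
    (P : EuclideanSpace ℝ (Fin 3) → Prop) [DecidablePred P] (hF'P : F' = F.filter P) :
    ∑ y ∈ F', ((∑' w : ↥(wrap ℓ F'), lennardJones (dist y (w : EuclideanSpace ℝ (Fin 3)))) - 2 * e)
      ≤ ∑ y ∈ F, ∑ w ∈ F, lennardJones (dist y w) + 2 * C * ((F.filter fun x => ¬ P x).card : ℝ) - 2 * e * (F'.card : ℝ) := by
  have hsite : ∑ y ∈ F', ((∑' w : ↥(wrap ℓ F'), lennardJones (dist y (w : EuclideanSpace ℝ (Fin 3)))) - 2 * e)
      ≤ ∑ y ∈ F', (∑ w ∈ F', lennardJones (dist y w) - 2 * e) :=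
    Finset.sum_le_sum fun y hy => by linarith [wrap_site_le hℓ hδ hTrim hsep hy]
  have e1 : ∑ y ∈ F', (∑ w ∈ F', lennardJones (dist y w) - 2 * e)
      = ∑ y ∈ F', ∑ w ∈ F', lennardJones (dist y w) - 2 * e * (F'.card : ℝ) := by
    rw [Finset.sum_sub_distrib, Finset.sum_const, nsmul_eq_mul]; ring
  have htrim := pair_sum_trim_le hδ F hFsep P
  rw [← hF'P, ← hC] at htrim
  linarith

/-- **B.** The pair sum of a patch equals its site charge minus the cube cross term plus `2e·#F`. -/
theorem patch_pair_sum_eq (e : ℝ) {Y : Set (EuclideanSpace ℝ (Fin 3))} (hUD : UniformlyDiscrete Y)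
    (F : Finset (EuclideanSpace ℝ (Fin 3))) (hFY : (↑F : Set (EuclideanSpace ℝ (Fin 3))) ⊆ Y) :
    ∑ y ∈ F, ∑ w ∈ F, lennardJones (dist y w)
      = ∑ y ∈ F, ((∑' w : ↥Y, lennardJones (dist y (w : EuclideanSpace ℝ (Fin 3)))) - 2 * e)
        - ∑ y ∈ F, ∑' w : ↥(Y \ ↑F), lennardJones (dist y (w : EuclideanSpace ℝ (Fin 3))) + 2 * e * (F.card : ℝ) := by
  have hsplit := fun y => stub_siteSumSplit Y hUD F hFY y
  rw [Finset.sum_sub_distrib, Finset.sum_const, nsmul_eq_mul, Finset.sum_congr rfl (fun y _ => hsplit y),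
    Finset.sum_add_distrib]
  ring

/-- **C.** The rim cost is `O(ℓ²)`, hence below `γ/2 · ℓ³` at the chosen scale. -/
theorem rim_cost_lt {δ γ K C ae r ℓ : ℝ} (hδ : 0 < δ) (hγ : 0 < γ) (hC : 0 ≤ C) (hae : 0 ≤ ae)
    (hK : K = 3 * (2 * 1 / δ + 1) * (2 / δ + 1) ^ 2 * (2 * C + 2 * ae)) (hℓ1 : 1 ≤ ℓ) (hℓK : 2 * K / γ + 1 ≤ ℓ)
    (hr : r ≤ 3 * ((2 * 1 / δ + 1) * (2 * ℓ / δ + 1) ^ 2)) :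
    (2 * C + 2 * ae) * r < γ / 2 * ℓ ^ 3 := by
  have h1 : 2 * ℓ / δ + 1 ≤ (2 / δ + 1) * ℓ := by
    have e : (2 / δ + 1) * ℓ = 2 * ℓ / δ + ℓ := by ring
    rw [e]; linarith
  have h0 : 0 ≤ 2 * ℓ / δ + 1 := by
    have : 0 ≤ 2 * ℓ / δ := div_nonneg (by linarith) hδ.le
    linarith
  have h2 : (2 * ℓ / δ + 1) ^ 2 ≤ ((2 / δ + 1) * ℓ) ^ 2 := pow_le_pow_left₀ h0 h1 2
  have h3 : 0 ≤ 3 * (2 * 1 / δ + 1) := by positivity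
  have hr2 : r ≤ 3 * (2 * 1 / δ + 1) * (2 / δ + 1) ^ 2 * ℓ ^ 2 :=
    calc r ≤ 3 * ((2 * 1 / δ + 1) * (2 * ℓ / δ + 1) ^ 2) := hr
      _ = 3 * (2 * 1 / δ + 1) * (2 * ℓ / δ + 1) ^ 2 := by ring
      _ ≤ 3 * (2 * 1 / δ + 1) * ((2 / δ + 1) * ℓ) ^ 2 := mul_le_mul_of_nonneg_left h2 h3
      _ = 3 * (2 * 1 / δ + 1) * (2 / δ + 1) ^ 2 * ℓ ^ 2 := by ring
  have hcost : (2 * C + 2 * ae) * r ≤ K * ℓ ^ 2 := by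
    have h4 : 0 ≤ 2 * C + 2 * ae := by positivity
    calc (2 * C + 2 * ae) * r ≤ (2 * C + 2 * ae) * (3 * (2 * 1 / δ + 1) * (2 / δ + 1) ^ 2 * ℓ ^ 2) :=
          mul_le_mul_of_nonneg_left hr2 h4
      _ = K * ℓ ^ 2 := by rw [hK]; ring
  have e1 : γ / 2 * (2 * K / γ + 1) = K + γ / 2 := by
    calc γ / 2 * (2 * K / γ + 1) = γ / γ * K + γ / 2 := by ring
      _ = K + γ / 2 := by rw [div_self hγ.ne', one_mul]
  have h4 : γ / 2 * (2 * K / γ + 1) ≤ γ / 2 * ℓ := mul_le_mul_of_nonneg_left hℓK (by positivity)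
  have h5 : K < γ / 2 * ℓ := by rw [e1] at h4; linarith
  have h6 : 0 < ℓ ^ 2 := pow_pos (by linarith) 2
  have h7 : K * ℓ ^ 2 < γ / 2 * ℓ * ℓ ^ 2 := mul_lt_mul_of_pos_right h5 h6
  have h8 : γ / 2 * ℓ * ℓ ^ 2 = γ / 2 * ℓ ^ 3 := by ring
  linarith

/-- **PER (tight periodisation, 0 sorry).** `PeriodicDefectPricing ⟹ TypeFreeLaw D` for every core radius `D ≥ 0`. [this node] -/
theorem typeFreeLaw_of_periodicDefectPricing (hP : PeriodicDefectPricing) {D : ℝ} (hD : 0 ≤ D) : TypeFreeLaw D := by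
  intro e hT hlb Y hUD hsolid a ha1 ha2 t ht ht1 L hthin hviol
  classical
  obtain ⟨δ, hδ, hsep⟩ := id hUD
  -- violator spacing made nonnegative
  have hL0 : 0 ≤ max L 0 := le_max_right _ _
  have hviol' : ∀ q ∈ Y, ∃ y ∈ Y, dist y q ≤ max L 0 ∧ ¬ RT a t Y y := fun q hq => by
    obtain ⟨y, hy, hd, hn⟩ := hviol q hq
    exact ⟨y, hy, hd.trans (le_max_left _ _), hn⟩
  -- the periodic price
  obtain ⟨γ, hγ, ℓ₁, hPℓ⟩ :=
    hP e hT hlb (min δ 1) (lt_min hδ one_pos) a ha1 ha2 t ht ht1 (3 * D + 8) (3 * max L 0 + 11)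
  refine ⟨γ / 4, by positivity, fun ℓ₀ => ?_⟩
  by_contra hflat
  simp only [not_exists, not_and, not_lt] at hflat
  -- the cube cross term at level γ/4
  obtain ⟨ℓ₂, hℓ₂⟩ := stub_crossTermSmall Y hUD (γ / 4) (by positivity)
  -- constants of the rim cost
  obtain ⟨C, hC⟩ : ∃ C : ℝ, C = 432 * (δ⁻¹ ^ 6 + 1) * δ⁻¹ ^ 3 * δ⁻¹ ^ 3 := ⟨_, rfl⟩
  have hC0 : 0 ≤ C := by rw [hC]; positivity
  obtain ⟨K, hK⟩ : ∃ K : ℝ, K = 3 * (2 * 1 / δ + 1) * (2 / δ + 1) ^ 2 * (2 * C + 2 * |e|) := ⟨_, rfl⟩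
  have hK0 : 0 ≤ K := by rw [hK]; positivity
  -- the scale
  obtain ⟨ℓ, hℓ0, hℓ1, hℓ2, hℓbig, hℓK⟩ :
      ∃ ℓ : ℝ, ℓ₀ ≤ ℓ ∧ ℓ₁ ≤ ℓ ∧ ℓ₂ ≤ ℓ ∧ 2 * max L 0 + 2 * D + 11 ≤ ℓ ∧ 2 * K / γ + 1 ≤ ℓ := by
    refine ⟨max (max (max ℓ₀ ℓ₁) (max ℓ₂ (2 * max L 0 + 2 * D + 11))) (2 * K / γ + 1), ?_, ?_, ?_, ?_, le_max_right _ _⟩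
    · exact le_trans (le_trans (le_max_left _ _) (le_max_left _ _)) (le_max_left _ _)
    · exact le_trans (le_trans (le_max_right _ _) (le_max_left _ _)) (le_max_left _ _)
    · exact le_trans (le_trans (le_max_left _ _) (le_max_right _ _)) (le_max_left _ _)
    · exact le_trans (le_trans (le_max_right _ _) (le_max_right _ _)) (le_max_left _ _)
  have hKγ : 0 ≤ 2 * K / γ := by positivity
  have hℓone : 1 ≤ ℓ := by linarith
  have hℓ3 : 3 ≤ ℓ := by linarith
  have hℓpos : 0 < ℓ := by linarith
  -- the cube, its patch F, the trimmed patch F', the rim R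
  obtain ⟨c⟩ : Nonempty (EuclideanSpace ℝ (Fin 3)) := ⟨0⟩
  obtain ⟨F, hF⟩ : ∃ F : Finset (EuclideanSpace ℝ (Fin 3)),
      (↑F : Set (EuclideanSpace ℝ (Fin 3))) = Y ∩ {z | ∀ i : Fin 3, c i ≤ z i ∧ z i < c i + ℓ} :=
    ⟨(finite_inter_cube hUD c hℓpos.le).toFinset, Set.Finite.coe_toFinset _⟩
  have hFY : (↑F : Set (EuclideanSpace ℝ (Fin 3))) ⊆ Y := by rw [hF]; exact Set.inter_subset_left
  have hmemF : ∀ z, z ∈ F ↔ z ∈ Y ∧ ∀ i : Fin 3, c i ≤ z i ∧ z i < c i + ℓ := fun z => by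
    rw [← Finset.mem_coe, hF]; exact Iff.rfl
  have hFsep : ∀ z ∈ F, ∀ w ∈ F, z ≠ w → δ ≤ dist z w :=
    fun z hz w hw hne => hsep z ((hmemF z).1 hz).1 w ((hmemF w).1 hw).1 hne
  have hFcube : ∀ z ∈ F, ∀ i : Fin 3, c i ≤ z i ∧ z i < c i + ℓ := fun z hz => ((hmemF z).1 hz).2
  obtain ⟨F', hF'def⟩ :
      ∃ F' : Finset (EuclideanSpace ℝ (Fin 3)), F' = F.filter (fun z => ∀ i : Fin 3, z i < c i + (ℓ - 1)) := ⟨_, rfl⟩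
  obtain ⟨R, hRdef⟩ :
      ∃ R : Finset (EuclideanSpace ℝ (Fin 3)), R = F.filter (fun z => ¬ ∀ i : Fin 3, z i < c i + (ℓ - 1)) := ⟨_, rfl⟩
  have hTrim : IsTrim Y c ℓ F' := fun w => by
    rw [hF'def, Finset.mem_filter, hmemF]
    constructor
    · rintro ⟨⟨hwY, hwc⟩, hw'⟩; exact ⟨hwY, fun i => ⟨(hwc i).1, hw' i⟩⟩
    · rintro ⟨hwY, hw⟩; exact ⟨⟨hwY, fun i => ⟨(hw i).1, by linarith [(hw i).2]⟩⟩, fun i => (hw i).2⟩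
  have hRF : ∀ z ∈ R, z ∈ F ∧ ∃ i : Fin 3, c i + (ℓ - 1) ≤ z i := fun z hz => by
    rw [hRdef, Finset.mem_filter] at hz
    obtain ⟨hzF, hnot⟩ := hz
    refine ⟨hzF, ?_⟩
    by_contra hall
    apply hnot
    intro i
    by_contra hi
    exact hall ⟨i, not_lt.mp hi⟩
  have hcard : (F.card : ℝ) = (F'.card : ℝ) + (R.card : ℝ) := by
    rw [hF'def, hRdef]; exact_mod_cast (Finset.card_filter_add_card_filter_not _).symm
  -- the wrap W = F' + ℓℤ³ and the periodic price of its cell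
  have hWF : (↑F' : Set (EuclideanSpace ℝ (Fin 3))) = wrap ℓ F' ∩ {z | ∀ i : Fin 3, c i ≤ z i ∧ z i < c i + ℓ} :=
    (wrap_inter_cube hℓpos hTrim).symm
  have hcharge : γ * ℓ ^ 3 ≤ ∑ y ∈ F', ((∑' w : ↥(wrap ℓ F'), lennardJones (dist y (w : EuclideanSpace ℝ (Fin 3)))) - 2 * e) :=
    hPℓ ℓ hℓ1 (wrap ℓ F') (fun z hz k => wrap_periodic ℓ F' z hz k) (wrap_sep hℓpos.le hTrim hsep) (wrap_cover hℓ3 hTrim hsolid)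
      (wrap_thin hD (by linarith) ha2 hTrim hthin) (wrap_viol hL0 (by linarith) ha2 ht.le ht1 hTrim hsolid hviol') c F' hWF
  -- A, B, C and the flatness / cross-term bounds
  have hA := wrap_cell_charge_le (e := e) hℓpos.le hδ hTrim hsep hFsep hC
    (fun z : EuclideanSpace ℝ (Fin 3) => ∀ i : Fin 3, z i < c i + (ℓ - 1)) hF'def
  rw [← hRdef] at hA
  have hB := patch_pair_sum_eq e hUD F hFY
  have hcross : |∑ y ∈ F, ∑' w : ↥(Y \ ↑F), lennardJones (dist y (w : EuclideanSpace ℝ (Fin 3)))| ≤ γ / 4 * ℓ ^ 3 :=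
    hℓ₂ ℓ c hℓ2 F hF
  have hX := (abs_le.mp hcross).1
  have hflatF : ∑ y ∈ F, ((∑' w : ↥Y, lennardJones (dist y (w : EuclideanSpace ℝ (Fin 3)))) - 2 * e) ≤ γ / 4 * ℓ ^ 3 :=
    hflat ℓ c F hℓ0 hF
  have hrim : (R.card : ℝ) ≤ 3 * ((2 * 1 / δ + 1) * (2 * ℓ / δ + 1) ^ 2) := card_rim_le hδ hℓpos.le c F R hFcube hFsep hRF
  have hcostlt : (2 * C + 2 * |e|) * (R.card : ℝ) < γ / 2 * ℓ ^ 3 :=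
    rim_cost_lt hδ hγ hC0 (abs_nonneg e) hK hℓone hℓK hrim
  have heR : 2 * e * (R.card : ℝ) ≤ 2 * |e| * (R.card : ℝ) :=
    mul_le_mul_of_nonneg_right (mul_le_mul_of_nonneg_left (le_abs_self e) zero_le_two) (Nat.cast_nonneg _)
  have hcardE : 2 * e * (F.card : ℝ) = 2 * e * (F'.card : ℝ) + 2 * e * (R.card : ℝ) := by rw [hcard]; ring
  have hγℓ : 0 < γ * ℓ ^ 3 := by positivity
  -- γ ℓ³ ≤ γ/4 ℓ³ + γ/4 ℓ³ + (2C + 2|e|)·#R < γ ℓ³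
  linarith

/-- `PeriodicDefectPricing ⟹ TypeFreeLaw 10` (the core radius of the registered line) -/
theorem typeFreeLaw_ten_of_periodicDefectPricing (hP : PeriodicDefectPricing) : TypeFreeLaw 10 :=
  typeFreeLaw_of_periodicDefectPricing hP (by norm_num)

/-! ## §N  The cone through the periodic normal form -/

/-- **`PeriodicDefectPricing ⟹ DustLaw`** — the registered stub 5 of line v7 (`…MinimalCone.DustLaw`, pinned to the skeleton text by
`dustLaw_iff`), BY NAME. [this node] -/
theorem dustLaw_of_periodicDefectPricing (hP : PeriodicDefectPricing) : DustLaw :=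
  dustLaw_of_typeFreeLaw (typeFreeLaw_ten_of_periodicDefectPricing hP)

/-- **`PeriodicDefectPricing ⟹ HostedTarget 10`** — the hosted world closes on the periodic price alone. [this node] -/
theorem hostedTarget_of_periodicDefectPricing (hP : PeriodicDefectPricing) : HostedTarget 10 :=
  hostedTarget_of_typeFreeLaw (typeFreeLaw_ten_of_periodicDefectPricing hP)

/-- **The g23 cone: `PeriodicDefectPricing ∧ CleanlessExcessT ∧ CoherentResidual 10 ⟹ RDEF`** (0 sorry; the crux by name). Compare the
minimal cone of record `…MinimalCone.rdef_of_laws_coherent` (five hypotheses, three of them idea-needed laws). [this node] -/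
theorem rdef_of_periodicDefectPricing_coherent (hP : PeriodicDefectPricing) (hCE : CleanlessExcessT) (hR : CoherentResidual 10) :
    RobustDefectLimitWindows :=
  rdef_of_typeFreeLaw_coherent (typeFreeLaw_ten_of_periodicDefectPricing hP) hCE hR

end Summit.AtomisticToContinuum.Crystallization.Theorems.OverbindingBudgetPeriodicPricing
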